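import Mathlib
import HarnessLib

/-!
# Tightness of the three-moment method behind `PuffFloor` (negative-side lemma for crux `PuffFloor`, stmt-AtomisticToContinuum-11785)

Cycle-2 file of the refuter's negative-side chain for crux `PuffFloor` of route
`BECConjugateDomination` (cdisprove seat gen 2, 2026-08-16). TIGHTNESS of the intended proof's
engine: the crux's floor `S(k) ≥ |k|/√(|k|² + Θ)` is to come from the moments `m₀ = N S(k)`,
`m₁ = N|k|²` (f-sum rule), `m₃ ≤ N|k|⁴(|k|² + Θ)` (Puff's cubic sum rule) of the spectral measure of
`H - E₀ ≥ 0` in the vector `ρ_k† Ψ₀` via the Lyapunov–Hölder inequality `m₁³ ≤ m₀² m₃`.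

* `lintegral_pow_three_le_measure_sq_mul` — that inequality for an arbitrary measure and
  measurable `ω ≥ 0` (one Hölder step, exponents `(3, 3/2)`);
* `moment_method_tight_single_mode` — a one-atom measure (single-mode / Feynman–Bogoliubov
  structure) gives EQUALITY, so the three moments can never yield more than `|k|/√(|k|²+Θ)`:
  `Θ = O(ρ)` uniformly in `N` is NECESSARY for the method (the constant in Puff's `M₃` is the whole
  difficulty), though not for the statement.

No Theses statement is asserted. All `[folklore]`.
-/

noncomputable section

namespace Summit.AtomisticToContinuum.BoseEinsteinCondensation.Theorems.PuffFloor.Negative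

open MeasureTheory
open scoped ENNReal NNReal

/-! ### The three-moment (Hölder) step of the intended proof, and its tightness -/

/-- **Lyapunov–Hölder moment inequality `m₁³ ≤ m₀² m₃`**: for any measure `μ` (the spectral measure
of `H - E₀` in the vector `ρ_k† Ψ`, supported on `[0,∞)` BECAUSE `Ψ` is the exact minimiser) and any
measurable `ω ≥ 0`, `(∫ ω dμ)³ ≤ μ(univ)² · ∫ ω³ dμ`. With `m₀ = N S(k)`, `m₁ = N|k|²` (f-sum rule)
and `m₃ ≤ N|k|⁴(|k|² + Θ)` (Puff) this is exactly `S(k) ≥ |k|/√(|k|² + Θ)`: one Hölder step with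
exponents `(3, 3/2)`. [folklore] -/
theorem lintegral_pow_three_le_measure_sq_mul {α : Type*} [MeasurableSpace α] (μ : Measure α)
    {ω : α → ℝ≥0∞} (hω : AEMeasurable ω μ) :
    (∫⁻ x, ω x ∂μ) ^ 3 ≤ μ Set.univ ^ 2 * ∫⁻ x, ω x ^ 3 ∂μ := by
  have hpq : Real.HolderConjugate 3 (3 / 2) := ⟨by norm_num, by norm_num, by norm_num⟩
  have h := ENNReal.lintegral_mul_le_Lp_mul_Lq μ hpq hω (aemeasurable_const (b := (1 : ℝ≥0∞)))
  simp only [Pi.mul_apply, mul_one, ENNReal.one_rpow, lintegral_const, one_mul] at h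
  -- `h : ∫⁻ ω ≤ (∫⁻ ω ^ 3) ^ (1/3) * (μ univ) ^ (1/(3/2))`
  have h3 : ((∫⁻ x, ω x ^ (3 : ℝ) ∂μ) ^ (1 / 3 : ℝ) * μ Set.univ ^ (1 / (3 / 2) : ℝ)) ^ 3 =
      μ Set.univ ^ 2 * ∫⁻ x, ω x ^ 3 ∂μ := by
    rw [mul_pow, mul_comm]
    congr 1
    · rw [← ENNReal.rpow_natCast, ← ENNReal.rpow_mul]
      norm_num
    · rw [show (1 / 3 : ℝ) = ((3 : ℕ) : ℝ)⁻¹ by norm_num, ENNReal.rpow_inv_natCast_pow three_ne_zero]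
      simp_rw [show (3 : ℝ) = ((3 : ℕ) : ℝ) by norm_num, ENNReal.rpow_natCast]
  calc (∫⁻ x, ω x ∂μ) ^ 3
      ≤ ((∫⁻ x, ω x ^ (3 : ℝ) ∂μ) ^ (1 / 3 : ℝ) * μ Set.univ ^ (1 / (3 / 2) : ℝ)) ^ 3 :=
        pow_le_pow_left₀ bot_le h 3
    _ = μ Set.univ ^ 2 * ∫⁻ x, ω x ^ 3 ∂μ := h3

/-- **Tightness of the three-moment method (single-mode saturation)**: for a one-atom measure
`μ = M δ_{ω₀}` (Feynman/Bogoliubov single-mode structure) `m₁³ = m₀² m₃` EXACTLY. So the Hölder step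
loses nothing at Bogoliubov level and the method's output `|k|/√(|k|²+Θ)` cannot be improved by
re-using the same three moments: `Θ = O(ρ)` uniformly in `N` is NECESSARY for the intended proof
(not for the statement). [folklore] -/
theorem moment_method_tight_single_mode {α : Type*} [MeasurableSpace α] [MeasurableSingletonClass α]
    (x₀ : α) (M ω₀ : ℝ≥0∞) :
    (∫⁻ x, (fun _ => ω₀) x ∂(M • Measure.dirac x₀)) ^ 3 =
      (M • Measure.dirac x₀) Set.univ ^ 2 * ∫⁻ x, (fun _ => ω₀) x ^ 3 ∂(M • Measure.dirac x₀) := by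
  simp only [lintegral_const, Measure.smul_apply, measure_univ, smul_eq_mul, mul_one]
  ring


end Summit.AtomisticToContinuum.BoseEinsteinCondensation.Theorems.PuffFloor.Negative

end
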